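import Summits.RiemannHypothesis.RiemannHypothesis.Theorems.SuzukiWindowsDoorDecayExponentReal
import Summits.RiemannHypothesis.RiemannHypothesis.Theorems.SuzukiWindowsDoorOnsetTwoSharp

/-!
# SuzukiWindowsDoorMuOneBound — `μ₁ ≤ γ + log(√10/2) ≈ 1.035` for Suzuki's small-window constant, from the θ-flow decay law at `θ → 1⁺` (column DBR; RH-FREE)

LINE 1 — LABEL: RH-FREE cross-column inequality (Column 6's window operators ⟶ Column 2's ground-energy asymptotic);
bears_on: LADDER-RH B-D(b) → B-P(P2)/(P2-flow) (PROOF-OF-DATA around EXP-R2a, TARGET-v10 §E.1/§N.3).  WHAT THIS IS NOT: no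
sign of `ε(t)` at any fixed `t`, nothing about `ζ`'s zeros; nothing here bears on the truth of RH.

Suzuki's Thm 1.4 ([Su26]; tree: `Literature.NumberTheory.LFunctions.Suzuki2026_thm_1_4_asymptotic_holds`) says
`ε(a) = log(1/a) + μ₁ − log 2π − γ + O(a)` for some `μ₁ > 0` (the tree's lower bound: `μ₁ ≥ 1/12`).  By
`SuzukiWindowsDoorDecayExponentReal.mu_one_le_consecutive_real`, for EVERY real `θ₀ > 1`,
`μ₁ ≤ γ + log(θ₀‖A_{θ₀}‖/‖A_{θ₀+1}‖)`, and with the kernel onset bounds of `SuzukiWindowsDoorSmallWindowLawReal` §2,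
`μ₁ ≤ F(θ₀) := γ + log θ₀ + ½ log(2^{2θ₀}/((2θ₀−1)2θ₀)) − ½ log(2^{2θ₀+2}/((θ₀+1)²(2θ₀+3)))`; letting `θ₀ → 1⁺`
(`F` is continuous at `1`, `F(1) = γ + ½ log(5/2)`):

* **`mu_one_le_of_one_lt`**: `μ₁ ≤ F(θ₀)` for every `θ₀ > 1`;
* **`mu_one_le_limit`**: `μ₁ ≤ γ + ½ log(5/2) = γ + log(√10/2) (≈ 1.0354)` — improves `…DecayExponentSmallWindow.mu_one_le_explicit`
  (`≈ 1.406`, pair `(2,3)`);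
* **`mu_one_le_sharp`**: `μ₁ ≤ γ + ½ log(81/52) = γ + log(9/(2√13)) (≈ 0.7988)` — the NON-consecutive pair `(θ₀, 2)` with
  `θ₀ → 1⁺`, the Hilbert–Schmidt bound at `θ₀` and the SHARP test-function bound `‖A₂‖² ≥ 104/81`
  (`SuzukiWindowsDoorOnsetTwoSharp`).  (With DATA §ET1f-lite's certified `‖A₂‖` and the exact `‖A_1‖ = 4/π` the same
  argument would read `μ₁ ≤ γ + log((4/π)/1.1377) ≈ 0.69` — numerics, not kernel.)

References: [Su26] M. Suzuki, Thm 1.4; rh-dbr TARGET-v10 §E.1; DATA.md §EXP-R2a, §ET1i.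
-/

noncomputable section

-- D-0017: `Summit.<S>.<S>.…` is the designed namespace of a single-problem summit.
set_option linter.dupNamespace false

open MeasureTheory Set Filter Topology

namespace Summit.RiemannHypothesis.RiemannHypothesis.Theorems.SuzukiWindowsDoorMuOneBound

open Literature.NumberTheory.LFunctions Literature.Analysis.OperatorTheory
open Summit.RiemannHypothesis.RiemannHypothesis.Theorems.SuzukiWindowsDoorTempleGalerkin (exists_winOp)
open Summit.RiemannHypothesis.RiemannHypothesis.Theorems.SuzukiWindowsDoorSmallWindowLawReal
open Summit.RiemannHypothesis.RiemannHypothesis.Theorems.SuzukiWindowsDoorDecayExponentReal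
open Summit.RiemannHypothesis.RiemannHypothesis.Theorems.SuzukiWindowsDoorOnsetTwoSharp (sq_opNorm_onsetTwo_ge)

/-- **RH-FREE · the bound family**: for every real `θ₀ > 1` and every admissible `μ₁`,
`μ₁ ≤ γ + log θ₀ + ½ log(2^{2θ₀}/((2θ₀−1)2θ₀)) − ½ log(2^{2θ₀+2}/((θ₀+1)²(2θ₀+3)))`
(`mu_one_le_consecutive_real` + the kernel onset bounds; realisations exist by the tree's `L²`-kernel package). -/
theorem mu_one_le_of_one_lt {θ₀ : ℝ} (hθ₀ : 1 < θ₀) {μ₁ C a₀ : ℝ} (ha₀ : 0 < a₀)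
    (hε : ∀ a : ℝ, 0 < a → a ≤ a₀ → |weilGroundEnergy a -
        (Real.log (1 / a) + μ₁ - Real.log (2 * Real.pi) - Real.eulerMascheroniConstant)| ≤ C * a) :
    μ₁ ≤ Real.eulerMascheroniConstant + Real.log θ₀ +
      Real.log ((2 : ℝ) ^ (2 * θ₀) / ((2 * θ₀ - 1) * (2 * θ₀))) / 2 -
      Real.log ((2 : ℝ) ^ (2 * (θ₀ + 1)) / ((θ₀ + 1) ^ 2 * (2 * (θ₀ + 1) + 1))) / 2 := by
  have hθ0 : 0 < θ₀ := by linarith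
  have hθ₁ : 1 < θ₀ + 1 := by linarith
  -- realisations
  have hK₀ : Continuous (limKernel θ₀) := Suzuki2020_thm12_continuous hθ₀
  have hK₁ : Continuous (limKernel (θ₀ + 1)) := Suzuki2020_thm12_continuous hθ₁
  have hb₀ : Continuous fun w : ℝ => (max w 0) ^ (θ₀ - 1) :=
    (continuous_id.max continuous_const).rpow_const fun _ => Or.inr (by linarith)
  have hb₁ : Continuous fun w : ℝ => (max w 0) ^ θ₀ :=
    (continuous_id.max continuous_const).rpow_const fun _ => Or.inr (by linarith)
  choose A₀ hA₀ using fun t : ℝ => exists_winOp hK₀ t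
  choose A₁ hA₁ using fun t : ℝ => exists_winOp hK₁ t
  obtain ⟨B₀, hB₀⟩ := exists_winOp hb₀ 1
  obtain ⟨B₁, hB₁⟩ := exists_winOp hb₁ 1
  have h := mu_one_le_consecutive_real (A₀ := A₀) (A₁ := A₁) hθ₀ hA₀ hA₁ hB₀ hB₁ ha₀ hε
  have hB₀pos := opNorm_onsetOp_pos_real hθ₀ hB₀
  have hB₁' : ∀ φ, (B₁ φ : ℝ → ℝ) =ᵐ[volume.restrict (Ioo (-1 : ℝ) 1)]
      fun u => ∫ v in Ioo (-1 : ℝ) 1, (max (u + v) 0) ^ (θ₀ + 1 - 1) * φ v := fun φ => by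
    rw [add_sub_cancel_right]; exact hB₁ φ
  have hB₁pos := opNorm_onsetOp_pos_real hθ₁ hB₁'
  -- the onset bounds
  have hu : ‖B₀‖ ^ 2 ≤ (2 : ℝ) ^ (2 * θ₀) / ((2 * θ₀ - 1) * (2 * θ₀)) := sq_opNorm_onsetOp_le_real hθ₀ hB₀
  have hl : (2 : ℝ) ^ (2 * (θ₀ + 1)) / ((θ₀ + 1) ^ 2 * (2 * (θ₀ + 1) + 1)) ≤ ‖B₁‖ ^ 2 :=
    sq_opNorm_onsetOp_ge_real hθ₁ hB₁'
  have hU : 0 < (2 : ℝ) ^ (2 * θ₀) / ((2 * θ₀ - 1) * (2 * θ₀)) := by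
    have : 0 < 2 * θ₀ - 1 := by linarith
    have : 0 < (2 : ℝ) ^ (2 * θ₀) := Real.rpow_pos_of_pos two_pos _
    positivity
  have hL : 0 < (2 : ℝ) ^ (2 * (θ₀ + 1)) / ((θ₀ + 1) ^ 2 * (2 * (θ₀ + 1) + 1)) := by
    have : 0 < (2 : ℝ) ^ (2 * (θ₀ + 1)) := Real.rpow_pos_of_pos two_pos _
    positivity
  -- logs: `2 log ‖B₀‖ ≤ log U`, `log L ≤ 2 log ‖B₁‖`
  have h1 : 2 * Real.log ‖B₀‖ ≤ Real.log ((2 : ℝ) ^ (2 * θ₀) / ((2 * θ₀ - 1) * (2 * θ₀))) := by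
    rw [← Real.log_rpow hB₀pos, show ‖B₀‖ ^ (2 : ℝ) = ‖B₀‖ ^ 2 by norm_cast]
    exact Real.log_le_log (by positivity) hu
  have h2 : Real.log ((2 : ℝ) ^ (2 * (θ₀ + 1)) / ((θ₀ + 1) ^ 2 * (2 * (θ₀ + 1) + 1))) ≤ 2 * Real.log ‖B₁‖ := by
    rw [← Real.log_rpow hB₁pos, show ‖B₁‖ ^ (2 : ℝ) = ‖B₁‖ ^ 2 by norm_cast]
    exact Real.log_le_log hL hl
  rw [Real.log_div (by positivity) hB₁pos.ne', Real.log_mul hθ0.ne' hB₀pos.ne'] at h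
  linarith

/-- **RH-FREE · `μ₁ ≤ γ + ½ log(5/2) = γ + log(√10/2) ≈ 1.0354`** for every `μ₁` admissible in Suzuki's small-window
asymptotic of Weil's ground energy — the `θ₀ → 1⁺` end of `mu_one_le_of_one_lt` (the bound function is continuous at
`θ₀ = 1`).  A cross-column consistency inequality (the tree's bracket becomes `1/12 ≤ μ₁ ≤ γ + ½ log(5/2)`); nothing here
bears on RH. -/
theorem mu_one_le_limit {μ₁ C a₀ : ℝ} (ha₀ : 0 < a₀)
    (hε : ∀ a : ℝ, 0 < a → a ≤ a₀ → |weilGroundEnergy a -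
        (Real.log (1 / a) + μ₁ - Real.log (2 * Real.pi) - Real.eulerMascheroniConstant)| ≤ C * a) :
    μ₁ ≤ Real.eulerMascheroniConstant + Real.log (5 / 2) / 2 := by
  set F : ℝ → ℝ := fun θ => Real.eulerMascheroniConstant + Real.log θ +
      Real.log ((2 : ℝ) ^ (2 * θ) / ((2 * θ - 1) * (2 * θ))) / 2 -
      Real.log ((2 : ℝ) ^ (2 * (θ + 1)) / ((θ + 1) ^ 2 * (2 * (θ + 1) + 1))) / 2 with hF
  have hbound : ∀ᶠ θ in 𝓝[>] (1 : ℝ), μ₁ ≤ F θ := by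
    filter_upwards [self_mem_nhdsWithin] with θ hθ
    exact mu_one_le_of_one_lt hθ ha₀ hε
  -- continuity of `F` at `1`
  have hcont : ContinuousAt F 1 := by
    have h2 : ∀ y : ℝ, ContinuousAt (fun θ : ℝ => (2 : ℝ) ^ y) 1 := fun y => continuousAt_const
    have hp : ∀ g : ℝ → ℝ, Continuous g → ContinuousAt (fun θ : ℝ => (2 : ℝ) ^ (g θ)) 1 := fun g hg =>
      (Real.continuousAt_const_rpow (by norm_num : (2 : ℝ) ≠ 0)).comp (hg.continuousAt)
    have hA : ContinuousAt (fun θ : ℝ => Real.log ((2 : ℝ) ^ (2 * θ) / ((2 * θ - 1) * (2 * θ)))) 1 := by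
      refine (Real.continuousAt_log ?_).comp ?_
      · norm_num
      · exact ((hp (fun θ => 2 * θ) (by fun_prop)).div (by fun_prop) (by norm_num))
    have hB : ContinuousAt (fun θ : ℝ => Real.log ((2 : ℝ) ^ (2 * (θ + 1)) / ((θ + 1) ^ 2 * (2 * (θ + 1) + 1)))) 1 := by
      refine (Real.continuousAt_log ?_).comp ?_
      · norm_num
      · exact ((hp (fun θ => 2 * (θ + 1)) (by fun_prop)).div (by fun_prop) (by norm_num))
    have hlog : ContinuousAt (fun θ : ℝ => Real.log θ) 1 := Real.continuousAt_log one_ne_zero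
    simp only [hF]
    exact (((continuousAt_const.add hlog).add (hA.div_const 2)).sub (hB.div_const 2))
  have htend : Tendsto F (𝓝[>] 1) (𝓝 (F 1)) := hcont.tendsto.mono_left nhdsWithin_le_nhds
  have hle : μ₁ ≤ F 1 := ge_of_tendsto htend hbound
  -- evaluate `F 1 = γ + ½ log(5/2)`
  have hF1 : F 1 = Real.eulerMascheroniConstant + Real.log (5 / 2) / 2 := by
    simp only [hF, Real.log_one, add_zero]
    have e1 : (2 : ℝ) ^ (2 * (1 : ℝ)) / ((2 * 1 - 1) * (2 * 1)) = 2 := by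
      rw [show (2 : ℝ) * 1 = ((2 : ℕ) : ℝ) by norm_num, Real.rpow_natCast]; norm_num
    have e2 : (2 : ℝ) ^ (2 * ((1 : ℝ) + 1)) / (((1 : ℝ) + 1) ^ 2 * (2 * (1 + 1) + 1)) = 4 / 5 := by
      rw [show (2 : ℝ) * ((1 : ℝ) + 1) = ((4 : ℕ) : ℝ) by norm_num, Real.rpow_natCast]; norm_num
    rw [e1, e2, show Real.log (5 / 2) = Real.log 2 - Real.log (4 / 5) by
      rw [← Real.log_div (by norm_num) (by norm_num)]; norm_num]
    ring
  linarith [hle, hF1.le, hF1.ge]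

/-- **RH-FREE · the non-consecutive bound family**: for `1 < θ₀ < 2` and every admissible `μ₁`,
`μ₁ ≤ log 2π + γ + (log c_{θ₀} + ½ log(2^{2θ₀}/((2θ₀−1)2θ₀)) − log c₂ − ½ log(104/81))/(2 − θ₀)` (`c_θ = (2π)^θ/Γ(θ)`;
pair `(θ₀, 2)` in `mu_one_le_real`, Hilbert–Schmidt at `θ₀`, `‖A₂‖² ≥ 104/81`). -/
theorem mu_one_le_of_lt_two {θ₀ : ℝ} (hθ₀ : 1 < θ₀) (hθ₂ : θ₀ < 2) {μ₁ C a₀ : ℝ} (ha₀ : 0 < a₀)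
    (hε : ∀ a : ℝ, 0 < a → a ≤ a₀ → |weilGroundEnergy a -
        (Real.log (1 / a) + μ₁ - Real.log (2 * Real.pi) - Real.eulerMascheroniConstant)| ≤ C * a) :
    μ₁ ≤ Real.log (2 * Real.pi) + Real.eulerMascheroniConstant +
      (Real.log ((2 * Real.pi) ^ θ₀ / Real.Gamma θ₀) +
        Real.log ((2 : ℝ) ^ (2 * θ₀) / ((2 * θ₀ - 1) * (2 * θ₀))) / 2 -
        Real.log ((2 * Real.pi) ^ (2 : ℝ) / Real.Gamma 2) - Real.log (104 / 81) / 2) / (2 - θ₀) := by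
  have hθ0 : 0 < θ₀ := by linarith
  have h2π : 0 < 2 * Real.pi := by positivity
  have hK₀ : Continuous (limKernel θ₀) := Suzuki2020_thm12_continuous hθ₀
  have hK₁ : Continuous (limKernel 2) := Suzuki2020_thm12_continuous (by norm_num)
  have hb₀ : Continuous fun w : ℝ => (max w 0) ^ (θ₀ - 1) :=
    (continuous_id.max continuous_const).rpow_const fun _ => Or.inr (by linarith)
  have hb₁ : Continuous fun w : ℝ => (max w 0) ^ ((2 : ℝ) - 1) :=
    (continuous_id.max continuous_const).rpow_const fun _ => Or.inr (by norm_num)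
  choose A₀ hA₀ using fun t : ℝ => exists_winOp hK₀ t
  choose A₁ hA₁ using fun t : ℝ => exists_winOp hK₁ t
  obtain ⟨B₀, hB₀⟩ := exists_winOp hb₀ 1
  obtain ⟨B₁, hB₁⟩ := exists_winOp hb₁ 1
  have h := mu_one_le_real (A₀ := A₀) (A₁ := A₁) hθ₀ hθ₂ hA₀ hA₁ hB₀ hB₁ ha₀ hε
  have hB₀pos := opNorm_onsetOp_pos_real hθ₀ hB₀
  have hB₁pos := opNorm_onsetOp_pos_real (by norm_num : (1 : ℝ) < 2) hB₁
  have hc₀ : 0 < (2 * Real.pi) ^ θ₀ / Real.Gamma θ₀ := by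
    have := Real.rpow_pos_of_pos h2π θ₀
    have := Real.Gamma_pos_of_pos hθ0
    positivity
  have hc₂ : 0 < (2 * Real.pi) ^ (2 : ℝ) / Real.Gamma 2 := by
    have := Real.rpow_pos_of_pos h2π (2 : ℝ)
    have := Real.Gamma_pos_of_pos (by norm_num : (0 : ℝ) < 2)
    positivity
  have hu : ‖B₀‖ ^ 2 ≤ (2 : ℝ) ^ (2 * θ₀) / ((2 * θ₀ - 1) * (2 * θ₀)) := sq_opNorm_onsetOp_le_real hθ₀ hB₀
  have hl : (104 : ℝ) / 81 ≤ ‖B₁‖ ^ 2 := sq_opNorm_onsetTwo_ge hB₁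
  have hU : 0 < (2 : ℝ) ^ (2 * θ₀) / ((2 * θ₀ - 1) * (2 * θ₀)) := by
    have : 0 < 2 * θ₀ - 1 := by linarith
    have : 0 < (2 : ℝ) ^ (2 * θ₀) := Real.rpow_pos_of_pos two_pos _
    positivity
  have h1 : 2 * Real.log ‖B₀‖ ≤ Real.log ((2 : ℝ) ^ (2 * θ₀) / ((2 * θ₀ - 1) * (2 * θ₀))) := by
    rw [← Real.log_rpow hB₀pos, show ‖B₀‖ ^ (2 : ℝ) = ‖B₀‖ ^ 2 by norm_cast]
    exact Real.log_le_log (by positivity) hu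
  have h2 : Real.log (104 / 81) ≤ 2 * Real.log ‖B₁‖ := by
    rw [← Real.log_rpow hB₁pos, show ‖B₁‖ ^ (2 : ℝ) = ‖B₁‖ ^ 2 by norm_cast]
    exact Real.log_le_log (by norm_num) hl
  -- expand the log of the ratio and divide by `2 − θ₀ > 0`
  have hdθ : 0 < 2 - θ₀ := by linarith
  rw [Real.log_div (by positivity) (by positivity), Real.log_mul hc₀.ne' hB₀pos.ne',
    Real.log_mul hc₂.ne' hB₁pos.ne'] at h
  have hmono : (Real.log ((2 * Real.pi) ^ θ₀ / Real.Gamma θ₀) + Real.log ‖B₀‖ -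
      (Real.log ((2 * Real.pi) ^ (2 : ℝ) / Real.Gamma 2) + Real.log ‖B₁‖)) / (2 - θ₀) ≤
      (Real.log ((2 * Real.pi) ^ θ₀ / Real.Gamma θ₀) +
        Real.log ((2 : ℝ) ^ (2 * θ₀) / ((2 * θ₀ - 1) * (2 * θ₀))) / 2 -
        Real.log ((2 * Real.pi) ^ (2 : ℝ) / Real.Gamma 2) - Real.log (104 / 81) / 2) / (2 - θ₀) := by
    apply div_le_div_of_nonneg_right _ hdθ.le
    linarith
  linarith

/-- **RH-FREE · `μ₁ ≤ γ + ½ log(81/52) = γ + log(9/(2√13)) ≈ 0.7988`** for every `μ₁` admissible in Suzuki's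
small-window asymptotic — the `θ₀ → 1⁺` end of `mu_one_le_of_lt_two` (`Γ` continuous at `1`, `Γ(1) = Γ(2) = 1`).
The tree's bracket becomes `1/12 ≤ μ₁ ≤ γ + ½ log(81/52)`; nothing here bears on RH. -/
theorem mu_one_le_sharp {μ₁ C a₀ : ℝ} (ha₀ : 0 < a₀)
    (hε : ∀ a : ℝ, 0 < a → a ≤ a₀ → |weilGroundEnergy a -
        (Real.log (1 / a) + μ₁ - Real.log (2 * Real.pi) - Real.eulerMascheroniConstant)| ≤ C * a) :
    μ₁ ≤ Real.eulerMascheroniConstant + Real.log (81 / 52) / 2 := by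
  have h2π : 0 < 2 * Real.pi := by positivity
  set G : ℝ → ℝ := fun θ => Real.log (2 * Real.pi) + Real.eulerMascheroniConstant +
      (Real.log ((2 * Real.pi) ^ θ / Real.Gamma θ) +
        Real.log ((2 : ℝ) ^ (2 * θ) / ((2 * θ - 1) * (2 * θ))) / 2 -
        Real.log ((2 * Real.pi) ^ (2 : ℝ) / Real.Gamma 2) - Real.log (104 / 81) / 2) / (2 - θ) with hG
  have hbound : ∀ᶠ θ in 𝓝[>] (1 : ℝ), μ₁ ≤ G θ := by
    filter_upwards [Ioo_mem_nhdsGT (show (1 : ℝ) < 2 by norm_num)] with θ hθ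
    exact mu_one_le_of_lt_two hθ.1 hθ.2 ha₀ hε
  have hcont : ContinuousAt G 1 := by
    have hp : ∀ g : ℝ → ℝ, Continuous g → ∀ {b : ℝ}, 0 < b → ContinuousAt (fun θ : ℝ => b ^ (g θ)) 1 :=
      fun g hg b hb => (Real.continuousAt_const_rpow hb.ne').comp hg.continuousAt
    have hΓ : ContinuousAt Real.Gamma 1 :=
      (Real.differentiableAt_Gamma fun m => by
        have : (0 : ℝ) ≤ m := Nat.cast_nonneg m
        linarith).continuousAt
    have hΓ1 : Real.Gamma 1 ≠ 0 := by rw [Real.Gamma_one]; norm_num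
    have hc : ContinuousAt (fun θ : ℝ => Real.log ((2 * Real.pi) ^ θ / Real.Gamma θ)) 1 := by
      refine (Real.continuousAt_log ?_).comp ((hp (fun θ => θ) continuous_id h2π).div hΓ hΓ1)
      rw [Real.Gamma_one, div_one]; exact (Real.rpow_pos_of_pos h2π _).ne'
    have hA : ContinuousAt (fun θ : ℝ => Real.log ((2 : ℝ) ^ (2 * θ) / ((2 * θ - 1) * (2 * θ)))) 1 := by
      refine (Real.continuousAt_log ?_).comp ?_
      · norm_num
      · exact ((hp (fun θ => 2 * θ) (by fun_prop) two_pos).div (by fun_prop) (by norm_num))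
    have hden : ContinuousAt (fun θ : ℝ => 2 - θ) 1 := by fun_prop
    simp only [hG]
    exact continuousAt_const.add ((((hc.add (hA.div_const 2)).sub continuousAt_const).sub
      continuousAt_const).div hden (by norm_num))
  have htend : Tendsto G (𝓝[>] 1) (𝓝 (G 1)) := hcont.tendsto.mono_left nhdsWithin_le_nhds
  have hle : μ₁ ≤ G 1 := ge_of_tendsto htend hbound
  have hG1 : G 1 = Real.eulerMascheroniConstant + Real.log (81 / 52) / 2 := by
    simp only [hG, Real.Gamma_one, Real.rpow_one, div_one, Real.Gamma_two]
    have e1 : (2 : ℝ) ^ (2 * (1 : ℝ)) / ((2 * 1 - 1) * (2 * 1)) = 2 := by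
      rw [show (2 : ℝ) * 1 = ((2 : ℕ) : ℝ) by norm_num, Real.rpow_natCast]; norm_num
    have e2 : (2 * Real.pi) ^ (2 : ℝ) = (2 * Real.pi) ^ 2 := by
      rw [show (2 : ℝ) = ((2 : ℕ) : ℝ) by norm_num, Real.rpow_natCast]
    rw [e1, e2, Real.log_pow, show Real.log (81 / 52) = Real.log 2 - Real.log (104 / 81) by
      rw [← Real.log_div (by norm_num) (by norm_num)]; norm_num]
    push_cast
    ring
  linarith [hle, hG1.le, hG1.ge]

/-- The sharp bound with Suzuki's theorem plugged in: the `μ₁` of `Suzuki2026_thm_1_4_asymptotic` can be CHOSEN `≤ γ + ½log(81/52)`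
(indeed every admissible `μ₁` is). -/
theorem exists_mu_one_le :
    ∃ μ₁ : ℝ, 0 < μ₁ ∧ μ₁ ≤ Real.eulerMascheroniConstant + Real.log (81 / 52) / 2 ∧
      ∃ C a₀ : ℝ, 0 < a₀ ∧ ∀ a : ℝ, 0 < a → a ≤ a₀ →
        |weilGroundEnergy a -
          (Real.log (1 / a) + μ₁ - Real.log (2 * Real.pi) - Real.eulerMascheroniConstant)| ≤ C * a := by
  obtain ⟨μ₁, hμ, C, a₀, ha₀, hε⟩ := Suzuki2026_thm_1_4_asymptotic_holds
  exact ⟨μ₁, hμ, mu_one_le_sharp ha₀ hε, C, a₀, ha₀, hε⟩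

end Summit.RiemannHypothesis.RiemannHypothesis.Theorems.SuzukiWindowsDoorMuOneBound

end
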